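import Mathlib
import HarnessLib

/-!
# The frame transfer (`stub_frameShadow`; crux `SemivaluationShadows`, line `birth`)

Registered sub-goal `stub_frameShadow` of the crux `stmt-ResolutionOfSingularities-16757`
(`Theses.AbhyankarShadows.SemivaluationShadows`, the EXISTENCE half of Teissier's semivaluation
conjecture typed over finite sets), line `birth`: the ANY-RANK TRANSFER lemma fed by every
construction of the open cores (the specialisation engine produces `φ : R₁ → L` together with a
monomial FRAME `e`).

Data: a rational valuation ring `O ∋ k` of `K/k` of rational rank `r`, a model `R ≤ R₁ ⊆ O`
(`R₁` finitely generated, `Frac R₁ = K`), a `k`-algebra map `φ : R₁ →ₐ[k] L` into a field `L`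
carrying a rational valuation ring `O'` with `φ(R₁) ⊆ O'` and the same centre, and a FRAME
`e : Fin r → R₁`: the values `v'(φ eᵢ)` generate the value group of `O'` (`hgen`), the values
`v(eᵢ)` are `ℤ`-independent (`hind`), the two families of monomials are ordered alike against `1`
(`hord`), every non-zero `v'(φ y)` is an `ℕ`-monomial in the `v'(φ eᵢ)` (`h5`), and on the finite
set `F` the two valuations have the same exponents (`hexF`). Conclusion: the `∃`-tail of the crux
(`HasShadow O R F`) witnessed by the SAME `R₁, L, φ, O'`.

Proof = MONOMIAL TRANSPORT (`Frame.exists_orderMonoidWithZeroHom`): every non-zero value of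
`O'` is `∏ v'(φ eᵢ) ^ mᵢ` for a UNIQUE `m ∈ ℤʳ` (`hord` at `± m` turns `∏ v'(φ e) ^ m = 1` into
`∏ v(e) ^ m = 1`, then `hind`), and `ι (∏ v'(φ e) ^ m) := ∏ v(e) ^ m`, `ι 0 := 0` is
multiplicative, injective (`hind`) and monotone (`hord` at `m₁ - m₂`); [rank] `m ↦ ∏ v'(φ e) ^ m`
is a group isomorphism `ℤʳ ≅ Γ_{O'}ˣ` (`Frame.finrank_additive_units`); [fg] the value
semigroup of `φ(R₁)` is the submonoid generated by `0` and the `v'(φ eᵢ)` (`h5`); [values]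
`ι (v'(φ y)) = v(∏ eᵢ ^ mᵢ)` with `m ∈ ℕʳ` from `h5`; [exact] `hexF`.

No named facts are used; everything here is ordered-group bookkeeping. [folklore]
-/

noncomputable section

-- single-problem summit: the doubled namespace component `ResolutionOfSingularities` is forced
set_option linter.dupNamespace false

namespace Summit.ResolutionOfSingularities.ResolutionOfSingularities.Theorems

namespace Frame

/-! ## Monomials `∏ aᵢ ^ mᵢ` (`m ∈ ℤ^σ`) in a linearly ordered commutative group with zero -/

section Monomial

variable {Γ : Type*} [LinearOrderedCommGroupWithZero Γ] {σ : Type*} [Fintype σ]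

/-- A monomial in non-zero elements is non-zero. [folklore] -/
theorem prod_zpow_ne_zero (a : σ → Γ) (ha : ∀ i, a i ≠ 0) (m : σ → ℤ) :
    (∏ i, a i ^ m i) ≠ 0 :=
  Finset.prod_ne_zero_iff.mpr fun i _ => zpow_ne_zero _ (ha i)

/-- Monomials are additive in the exponent. [folklore] -/
theorem prod_zpow_add (a : σ → Γ) (ha : ∀ i, a i ≠ 0) (m m' : σ → ℤ) :
    (∏ i, a i ^ (m + m') i) = (∏ i, a i ^ m i) * ∏ i, a i ^ m' i := by
  rw [← Finset.prod_mul_distrib]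
  exact Finset.prod_congr rfl fun i _ => by rw [Pi.add_apply, zpow_add₀ (ha i)]

/-- The monomial with opposite exponent is the inverse. [folklore] -/
theorem prod_zpow_neg (a : σ → Γ) (m : σ → ℤ) :
    (∏ i, a i ^ (-m) i) = (∏ i, a i ^ m i)⁻¹ := by
  rw [← Finset.prod_inv_distrib]
  exact Finset.prod_congr rfl fun i _ => by rw [Pi.neg_apply, zpow_neg]

/-- Monomials turn differences of exponents into quotients. [folklore] -/
theorem prod_zpow_sub (a : σ → Γ) (ha : ∀ i, a i ≠ 0) (m m' : σ → ℤ) :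
    (∏ i, a i ^ (m - m') i) = (∏ i, a i ^ m i) * (∏ i, a i ^ m' i)⁻¹ := by
  rw [sub_eq_add_neg, prod_zpow_add a ha, prod_zpow_neg]

/-- The monomial with exponents cast from `ℕ` is the ordinary monomial. [folklore] -/
theorem prod_zpow_natCast (a : σ → Γ) (m : σ → ℕ) :
    (∏ i, a i ^ ((m i : ℕ) : ℤ)) = ∏ i, a i ^ m i :=
  Finset.prod_congr rfl fun i _ => zpow_natCast (a i) (m i)

omit [Fintype σ] in
/-- A non-zero element of a linearly ordered commutative group with zero equals `1` iff both it
and its inverse are `≤ 1`. [folklore] -/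
theorem eq_one_iff_le_one_and_inv_le_one {x : Γ} (hx : x ≠ 0) : x = 1 ↔ x ≤ 1 ∧ x⁻¹ ≤ 1 := by
  constructor
  · rintro rfl
    simp
  · rintro ⟨h1, h2⟩
    refine le_antisymm h1 ?_
    calc (1 : Γ) = x * x⁻¹ := (mul_inv_cancel₀ hx).symm
      _ ≤ x * 1 := mul_le_mul' le_rfl h2
      _ = x := mul_one x

omit [Fintype σ] in
/-- In a linearly ordered commutative group with zero, `x ≤ y ↔ x * y⁻¹ ≤ 1` for `y ≠ 0`.
[folklore] -/
theorem le_iff_mul_inv_le_one {x y : Γ} (hy : y ≠ 0) : x ≤ y ↔ x * y⁻¹ ≤ 1 := by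
  constructor
  · intro h
    calc x * y⁻¹ ≤ y * y⁻¹ := mul_le_mul' h le_rfl
      _ = 1 := mul_inv_cancel₀ hy
  · intro h
    calc x = x * y⁻¹ * y := by rw [inv_mul_cancel_right₀ hy]
      _ ≤ 1 * y := mul_le_mul' h le_rfl
      _ = y := one_mul y

end Monomial

/-! ## Monomial transport along a frame -/

section Transport

variable {Γ₁ Γ₂ : Type*} [LinearOrderedCommGroupWithZero Γ₁] [LinearOrderedCommGroupWithZero Γ₂]
  {σ : Type*} [Fintype σ]

/-- **Frames detect `1`.** If the monomials in `a` and in `b` are ordered alike against `1`, then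
`∏ aᵢ ^ mᵢ = 1 ↔ ∏ bᵢ ^ mᵢ = 1` (apply the hypothesis at `m` and at `-m`). [folklore] -/
theorem prod_zpow_eq_one_iff (a : σ → Γ₁) (b : σ → Γ₂) (ha : ∀ i, a i ≠ 0)
    (hb : ∀ i, b i ≠ 0)
    (hord : ∀ m : σ → ℤ, (∏ i, a i ^ m i) ≤ 1 ↔ (∏ i, b i ^ m i) ≤ 1) (m : σ → ℤ) :
    (∏ i, a i ^ m i) = 1 ↔ (∏ i, b i ^ m i) = 1 := by
  rw [eq_one_iff_le_one_and_inv_le_one (prod_zpow_ne_zero a ha m),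
    eq_one_iff_le_one_and_inv_le_one (prod_zpow_ne_zero b hb m), ← prod_zpow_neg a,
    ← prod_zpow_neg b, hord m, hord (-m)]

/-- **Exponents along a frame are unique**: if moreover the `bᵢ` have `ℤ`-independent values,
`∏ aᵢ ^ mᵢ = ∏ aᵢ ^ m'ᵢ` forces `m = m'`. [folklore] -/
theorem eq_of_prod_zpow_eq (a : σ → Γ₁) (b : σ → Γ₂) (ha : ∀ i, a i ≠ 0)
    (hb : ∀ i, b i ≠ 0) (hind : ∀ m : σ → ℤ, (∏ i, b i ^ m i) = 1 → m = 0)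
    (hord : ∀ m : σ → ℤ, (∏ i, a i ^ m i) ≤ 1 ↔ (∏ i, b i ^ m i) ≤ 1) {m m' : σ → ℤ}
    (h : (∏ i, a i ^ m i) = ∏ i, a i ^ m' i) : m = m' := by
  have h1 : (∏ i, a i ^ (m - m') i) = 1 := by
    rw [prod_zpow_sub a ha, h, mul_inv_cancel₀ (prod_zpow_ne_zero a ha m')]
  exact sub_eq_zero.mp (hind _ ((prod_zpow_eq_one_iff a b ha hb hord _).mp h1))

/-- **Monomial transport.** Let `a : σ → Γ₁`, `b : σ → Γ₂` be finite families of non-zero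
elements of two linearly ordered commutative groups with zero such that every non-zero element of
`Γ₁` is a monomial `∏ aᵢ ^ mᵢ` (`m ∈ ℤ^σ`), the `bᵢ` are multiplicatively `ℤ`-independent, and
`∏ aᵢ ^ mᵢ ≤ 1 ↔ ∏ bᵢ ^ mᵢ ≤ 1` for all `m`. Then `∏ aᵢ ^ mᵢ ↦ ∏ bᵢ ^ mᵢ`, `0 ↦ 0` is a
well-defined injective ordered monoid-with-zero homomorphism `Γ₁ → Γ₂`. [folklore] -/
theorem exists_orderMonoidWithZeroHom (a : σ → Γ₁) (b : σ → Γ₂) (ha : ∀ i, a i ≠ 0)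
    (hb : ∀ i, b i ≠ 0) (hgen : ∀ g : Γ₁, g ≠ 0 → ∃ m : σ → ℤ, g = ∏ i, a i ^ m i)
    (hind : ∀ m : σ → ℤ, (∏ i, b i ^ m i) = 1 → m = 0)
    (hord : ∀ m : σ → ℤ, (∏ i, a i ^ m i) ≤ 1 ↔ (∏ i, b i ^ m i) ≤ 1) :
    ∃ ι : Γ₁ →*₀o Γ₂, Function.Injective ι ∧
      ∀ m : σ → ℤ, ι (∏ i, a i ^ m i) = ∏ i, b i ^ m i := by
  classical
  -- the exponent of a non-zero element
  choose expo hexpo using hgen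
  have hexpo' : ∀ (g : Γ₁) (hg : g ≠ 0) (m : σ → ℤ), g = ∏ i, a i ^ m i → expo g hg = m :=
    fun g hg m h => eq_of_prod_zpow_eq a b ha hb hind hord ((hexpo g hg).symm.trans h)
  have hdec : ∀ g : Γ₁, g ≠ 0 → ∃ m : σ → ℤ, g = ∏ i, a i ^ m i :=
    fun g hg => ⟨expo g hg, hexpo g hg⟩
  -- the map
  let f : Γ₁ → Γ₂ := fun g => if hg : g = 0 then 0 else ∏ i, b i ^ expo g hg i
  have hf0 : f 0 = 0 := by simp [f]
  have hf : ∀ m : σ → ℤ, f (∏ i, a i ^ m i) = ∏ i, b i ^ m i := by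
    intro m
    have hne := prod_zpow_ne_zero a ha m
    simp only [f, dif_neg hne]
    rw [hexpo' _ hne m rfl]
  have hf1 : f 1 = 1 := by
    have h := hf 0
    simpa using h
  have hmul : ∀ x y : Γ₁, f (x * y) = f x * f y := by
    intro x y
    by_cases hx : x = 0
    · rw [hx, zero_mul, hf0, zero_mul]
    by_cases hy : y = 0
    · rw [hy, mul_zero, hf0, mul_zero]
    obtain ⟨m, rfl⟩ := hdec x hx
    obtain ⟨m', rfl⟩ := hdec y hy
    rw [← prod_zpow_add a ha, hf, hf, hf, prod_zpow_add b hb]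
  have hmono : Monotone f := by
    intro x y hxy
    by_cases hx : x = 0
    · rw [hx, hf0]
      exact zero_le
    have hy : y ≠ 0 := by
      rintro rfl
      exact hx (le_zero_iff.mp hxy)
    obtain ⟨m, rfl⟩ := hdec x hx
    obtain ⟨m', rfl⟩ := hdec y hy
    rw [hf, hf, le_iff_mul_inv_le_one (prod_zpow_ne_zero b hb m'), ← prod_zpow_sub b hb,
      ← hord, prod_zpow_sub a ha, ← le_iff_mul_inv_le_one (prod_zpow_ne_zero a ha m')]
    exact hxy
  have hinj : Function.Injective f := by
    intro x y hxy
    by_cases hx : x = 0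
    · subst hx
      by_contra hy
      rw [hf0] at hxy
      obtain ⟨m', rfl⟩ := hdec y (Ne.symm hy)
      rw [hf] at hxy
      exact prod_zpow_ne_zero b hb m' hxy.symm
    by_cases hy : y = 0
    · subst hy
      rw [hf0] at hxy
      obtain ⟨m, rfl⟩ := hdec x hx
      rw [hf] at hxy
      exact absurd hxy (prod_zpow_ne_zero b hb m)
    obtain ⟨m, rfl⟩ := hdec x hx
    obtain ⟨m', rfl⟩ := hdec y hy
    rw [hf, hf] at hxy
    have h1 : (∏ i, b i ^ (m - m') i) = 1 := by
      rw [prod_zpow_sub b hb, hxy, mul_inv_cancel₀ (prod_zpow_ne_zero b hb m')]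
    rw [sub_eq_zero.mp (hind _ h1)]
  exact ⟨{ toFun := f
           map_zero' := hf0
           map_one' := hf1
           map_mul' := hmul
           monotone' := hmono }, hinj, hf⟩

/-- **The units of a framed group are `ℤ^σ`.** Under the hypotheses of
`exists_orderMonoidWithZeroHom`, `m ↦ ∏ aᵢ ^ mᵢ` is a group isomorphism
`ℤ^σ ≅ Γ₁ˣ`, so `Γ₁ˣ` (written additively) is free of rank `#σ`. [folklore] -/
theorem finrank_additive_units (a : σ → Γ₁) (b : σ → Γ₂) (ha : ∀ i, a i ≠ 0)
    (hb : ∀ i, b i ≠ 0) (hgen : ∀ g : Γ₁, g ≠ 0 → ∃ m : σ → ℤ, g = ∏ i, a i ^ m i)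
    (hind : ∀ m : σ → ℤ, (∏ i, b i ^ m i) = 1 → m = 0)
    (hord : ∀ m : σ → ℤ, (∏ i, a i ^ m i) ≤ 1 ↔ (∏ i, b i ^ m i) ≤ 1) :
    Module.finrank ℤ (Additive Γ₁ˣ) = Fintype.card σ := by
  classical
  let u : σ → Γ₁ˣ := fun i => Units.mk0 (a i) (ha i)
  have hu : ∀ m : σ → ℤ, (((∏ i, u i ^ m i : Γ₁ˣ) : Γ₁ˣ) : Γ₁) = ∏ i, a i ^ m i := by
    intro m
    rw [Units.coe_prod]
    exact Finset.prod_congr rfl fun i _ => by rw [Units.val_zpow_eq_zpow_val, Units.val_mk0]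
  let f : (σ → ℤ) →+ Additive Γ₁ˣ :=
    { toFun := fun m => Additive.ofMul (∏ i, u i ^ m i)
      map_zero' := by simp
      map_add' := fun m m' => by
        rw [← ofMul_mul, ← Finset.prod_mul_distrib]
        congr 1
        exact Finset.prod_congr rfl fun i _ => by rw [Pi.add_apply, zpow_add] }
  have hf : ∀ m : σ → ℤ, f m = Additive.ofMul (∏ i, u i ^ m i) := fun m => rfl
  have hinj : Function.Injective f := by
    intro m m' h
    rw [hf, hf] at h
    have h' : (((∏ i, u i ^ m i : Γ₁ˣ) : Γ₁ˣ) : Γ₁) = ((∏ i, u i ^ m' i : Γ₁ˣ) : Γ₁) := by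
      rw [Additive.ofMul.injective h]
    rw [hu, hu] at h'
    exact eq_of_prod_zpow_eq a b ha hb hind hord h'
  have hsurj : Function.Surjective f := by
    intro x
    have hx : ((Additive.toMul x : Γ₁ˣ) : Γ₁) ≠ 0 := Units.ne_zero _
    obtain ⟨m, hm⟩ := hgen _ hx
    refine ⟨m, ?_⟩
    rw [hf]
    refine (Equiv.apply_eq_iff_eq_symm_apply Additive.ofMul).mpr (Units.ext ?_)
    rw [hu]
    exact hm.symm
  have e : (σ → ℤ) ≃ₗ[ℤ] Additive Γ₁ˣ := LinearEquiv.ofBijective f.toIntLinearMap ⟨hinj, hsurj⟩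
  rw [← e.finrank_eq, Module.finrank_fintype_fun_eq_card]

end Transport

end Frame

/-! ## The frame transfer, binder form -/

/-- **The frame transfer** (binder form of the registered sub-goal `stub_frameShadow`; conclusion
= the crux's `HasShadow O R F` unfolded verbatim). Given a rational valuation ring `O ∋ k` of `K`
of rational rank `r`, a model `R ≤ R₁ ⊆ O`, a map `φ : R₁ →ₐ[k] L` into a field with a rational
valuation ring `O' ⊇ φ(R₁)` with the same centre, and a frame `e : Fin r → R₁` (module
docstring), the datum `(R₁, L, φ, O')` with `ι (∏ v'(φ eᵢ) ^ mᵢ) := ∏ v(eᵢ) ^ mᵢ`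
(`Frame.exists_orderMonoidWithZeroHom`) is a shadow of `(R, O)` exact on `F`. [folklore] -/
theorem frameShadow (k K : Type) [Field k] [Field K] [Algebra k K] (O : ValuationSubring K)
    (hk : ∀ c : k, algebraMap k K c ∈ O)
    (hrat : ∀ x : K, x ∈ O → ∃ c : k, O.valuation (x - algebraMap k K c) < 1) (r : ℕ)
    (hrr : Module.finrank ℤ (Additive (O.ValueGroup)ˣ) = r) (R R₁ : Subalgebra k K)
    (hle : R ≤ R₁) (h₁O : R₁.toSubring ≤ O.toSubring) (hfg₁ : R₁.FG)
    (hfrac : IsFractionRing R₁ K) (L : Type) [Field L] [Algebra k L] (φ : R₁ →ₐ[k] L)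
    (O' : ValuationSubring L) (hin : ∀ y : R₁, φ y ∈ O')
    (hcen : ∀ y : R₁, O'.valuation (φ y) < 1 ↔ O.valuation (y : K) < 1)
    (hrat' : ∀ z : L, z ∈ O' → ∃ c : k, O'.valuation (z - algebraMap k L c) < 1)
    (e : Fin r → R₁) (he0 : ∀ i, ((e i : R₁) : K) ≠ 0) (heφ : ∀ i, φ (e i) ≠ 0)
    (hgen : ∀ z : L, z ≠ 0 →
      ∃ m : Fin r → ℤ, O'.valuation z = ∏ i, O'.valuation (φ (e i)) ^ (m i))
    (hind : ∀ m : Fin r → ℤ, (∏ i, O.valuation ((e i : R₁) : K) ^ (m i)) = 1 → m = 0)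
    (hord : ∀ m : Fin r → ℤ, (∏ i, O'.valuation (φ (e i)) ^ (m i)) ≤ 1 ↔
      (∏ i, O.valuation ((e i : R₁) : K) ^ (m i)) ≤ 1)
    (h5 : ∀ y : R₁, φ y ≠ 0 →
      ∃ m : Fin r → ℕ, O'.valuation (φ y) = ∏ i, O'.valuation (φ (e i)) ^ (m i))
    (F : Finset R)
    (hexF : ∀ x ∈ F, ((x : R) : K) ≠ 0 → φ (Subalgebra.inclusion hle x) ≠ 0 ∧
      ∃ m : Fin r → ℤ, O'.valuation (φ (Subalgebra.inclusion hle x)) =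
        ∏ i, O'.valuation (φ (e i)) ^ (m i) ∧
        O.valuation ((x : R) : K) = ∏ i, O.valuation ((e i : R₁) : K) ^ (m i)) :
    ∃ (R₁ : Subalgebra k K) (hle : R ≤ R₁) (_ : R₁.toSubring ≤ O.toSubring), R₁.FG ∧
    IsFractionRing R₁ K ∧ ∃ (L : Type) (_ : Field L) (_ : Algebra k L) (φ : R₁ →ₐ[k] L)
    (O' : ValuationSubring L), Module.finrank ℤ (Additive (O'.ValueGroup)ˣ) =
      Module.finrank ℤ (Additive (O.ValueGroup)ˣ) ∧ (∀ y : R₁, φ y ∈ O') ∧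
    (∀ y : R₁, O'.valuation (φ y) < 1 ↔ O.valuation (y : K) < 1) ∧
    (∀ z : L, z ∈ O' → ∃ c : k, O'.valuation (z - algebraMap k L c) < 1) ∧
    (MonoidHom.mrange (O'.valuation.toMonoidWithZeroHom.toMonoidHom.comp
      φ.toRingHom.toMonoidHom)).FG ∧
    ∃ ι : O'.ValueGroup →*₀o O.ValueGroup, Function.Injective ι ∧
      (∀ y : R₁, φ y ≠ 0 → ∃ y' : R₁, ι (O'.valuation (φ y)) = O.valuation (y' : K)) ∧
      ∀ x ∈ F, ι (O'.valuation (φ (Subalgebra.inclusion hle x))) = O.valuation ((x : R) : K) := by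
  classical
  -- `hk` and `hrat` are part of the registered signature (the crux's standing hypotheses on `O`);
  -- the transfer itself does not need them.
  have _hk := hk
  have _hrat := hrat
  -- the two frames of values
  set a : Fin r → O'.ValueGroup := fun i => O'.valuation (φ (e i)) with ha_def
  set b : Fin r → O.ValueGroup := fun i => O.valuation ((e i : R₁) : K) with hb_def
  have ha : ∀ i, a i ≠ 0 := fun i => (Valuation.ne_zero_iff _).mpr (heφ i)
  have hb : ∀ i, b i ≠ 0 := fun i => (Valuation.ne_zero_iff _).mpr (he0 i)
  have hgen' : ∀ g : O'.ValueGroup, g ≠ 0 → ∃ m : Fin r → ℤ, g = ∏ i, a i ^ m i := by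
    intro g hg
    obtain ⟨z, rfl⟩ := O'.valuation_surjective g
    have hz : z ≠ 0 := fun h => hg (by rw [h, map_zero])
    exact hgen z hz
  obtain ⟨ι, hι_inj, hι⟩ := Frame.exists_orderMonoidWithZeroHom a b ha hb hgen' hind hord
  have hrank : Module.finrank ℤ (Additive (O'.ValueGroup)ˣ) = r := by
    rw [Frame.finrank_additive_units a b ha hb hgen' hind hord, Fintype.card_fin]
  refine ⟨R₁, hle, h₁O, hfg₁, hfrac, L, inferInstance, inferInstance, φ, O', ?_, hin, hcen, hrat',
    ?_, ι, hι_inj, ?_, ?_⟩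
  · -- [rank]
    rw [hrr, hrank]
  · -- [fg] the value semigroup of `φ(R₁)` is generated by `0` and the `v'(φ eᵢ)`
    set S : Finset O'.ValueGroup := insert 0 (Finset.univ.image a) with hS
    have hmemS : ∀ i, a i ∈ Submonoid.closure (S : Set O'.ValueGroup) := fun i =>
      Submonoid.subset_closure (by simp [hS])
    have h0S : (0 : O'.ValueGroup) ∈ Submonoid.closure (S : Set O'.ValueGroup) :=
      Submonoid.subset_closure (by simp [hS])
    refine ⟨S, le_antisymm ?_ ?_⟩
    · rw [Submonoid.closure_le]
      intro g hg
      rw [hS, Finset.coe_insert, Finset.coe_image, Finset.coe_univ, Set.image_univ] at hg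
      rcases hg with rfl | ⟨i, rfl⟩
      · exact ⟨0, by simp⟩
      · exact ⟨e i, rfl⟩
    · rintro g ⟨y, rfl⟩
      change O'.valuation (φ y) ∈ Submonoid.closure (S : Set O'.ValueGroup)
      by_cases hy : φ y = 0
      · rw [hy, map_zero]
        exact h0S
      · obtain ⟨m, hm⟩ := h5 y hy
        rw [hm]
        exact prod_mem fun i _ => pow_mem (hmemS i) _
  · -- [values]
    intro y hy
    obtain ⟨m, hm⟩ := h5 y hy
    refine ⟨∏ i, e i ^ m i, ?_⟩
    rw [hm, ← Frame.prod_zpow_natCast a, hι, Frame.prod_zpow_natCast b]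
    push_cast
    rw [map_prod]
    exact Finset.prod_congr rfl fun i _ => by rw [map_pow]
  · -- [exact]
    intro x hx
    by_cases hx0 : ((x : R) : K) = 0
    · have hx0' : x = 0 := by exact_mod_cast hx0
      subst hx0'
      simp
    · obtain ⟨-, m, h1, h2⟩ := hexF x hx hx0
      rw [h1, hι, h2]

/-- **Registered sub-goal `stub_frameShadow` of line `birth` for the crux `SemivaluationShadows`**
(the registered signature verbatim, fully quantified; it is `frameShadow`). [folklore] -/
theorem stub_frameShadow : ∀ (k K : Type) [Field k] [Field K] [Algebra k K] (O : ValuationSubring K), (∀ c : k, algebraMap k K c ∈ O) → (∀ x : K, x ∈ O → ∃ c : k, O.valuation (x - algebraMap k K c) < 1) → ∀ (r : ℕ), Module.finrank ℤ (Additive (O.ValueGroup)ˣ) = r → ∀ (R R₁ : Subalgebra k K) (hle : R ≤ R₁), R₁.toSubring ≤ O.toSubring → R₁.FG → IsFractionRing R₁ K → ∀ (L : Type) [Field L] [Algebra k L] (φ : R₁ →ₐ[k] L) (O' : ValuationSubring L), (∀ y : R₁, φ y ∈ O') → (∀ y : R₁, O'.valuation (φ y) < 1 ↔ O.valuation (y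 : K) < 1) → (∀ z : L, z ∈ O' → ∃ c : k, O'.valuation (z - algebraMap k L c) < 1) → ∀ (e : Fin r → R₁), (∀ i, ((e i : R₁) : K) ≠ 0) → (∀ i, φ (e i) ≠ 0) → (∀ z : L, z ≠ 0 → ∃ m : Fin r → ℤ, O'.valuation z = ∏ i, O'.valuation (φ (e i)) ^ (m i)) → (∀ m : Fin r → ℤ, (∏ i, O.valuation ((e i : R₁) : K) ^ (m i)) = 1 → m = 0) → (∀ m : Fin r → ℤ, (∏ i, O'.valuation (φ (e i)) ^ (m i)) ≤ 1 ↔ (∏ i, O.valuation ((e i : R₁) : K) ^ (m i)) ≤ 1) → (∀ y : R₁, φ y ≠ 0 → ∃ m : Fin r → ℕ, O'.valuation (φ y) = ∏ i, O'.valuation (φ (e i)) ^ (m i)) → ∀ F : Finset R, (∀ x ∈ F, ((x : R) : K) ≠ 0 → φ (Subalgebra.inclusion hle x) ≠ 0 ∧ ∃ m : Fin r → ℤ, O'.valuation (φ (Subalgebra.inclusion hle x)) = ∏ i, O'.valuation (φ (e i)) ^ (m i) ∧ O.valuation ((x : R) : K) = ∏ i, O.valuation ((e i : R₁) : K) ^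 (m i)) → ∃ (R₁ : Subalgebra k K) (hle : R ≤ R₁) (_ : R₁.toSubring ≤ O.toSubring), R₁.FG ∧ IsFractionRing R₁ K ∧ ∃ (L : Type) (_ : Field L) (_ : Algebra k L) (φ : R₁ →ₐ[k] L) (O' : ValuationSubring L), Module.finrank ℤ (Additive (O'.ValueGroup)ˣ) = Module.finrank ℤ (Additive (O.ValueGroup)ˣ) ∧ (∀ y : R₁, φ y ∈ O') ∧ (∀ y : R₁, O'.valuation (φ y) < 1 ↔ O.valuation (y : K) < 1) ∧ (∀ z : L, z ∈ O' → ∃ c : k, O'.valuation (z - algebraMap k L c) < 1) ∧ (MonoidHom.mrange (O'.valuation.toMonoidWithZeroHom.toMonoidHom.comp φ.toRingHom.toMonoidHom)).FG ∧ ∃ ι : O'.ValueGroup →*₀o O.ValueGroup, Function.Injective ι ∧ (∀ y : R₁, φ y ≠ 0 → ∃ y' : R₁, ι (O'.valuation (φ y)) = O.valuation (y' : K)) ∧ ∀ x ∈ F, ι (O'.valuation (φ (Subalgebra.inclusion hle x))) = O.valuation ((x : R) : K) :=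
  frameShadow

end Summit.ResolutionOfSingularities.ResolutionOfSingularities.Theorems

end
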